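import Literature.MathematicalPhysics.QuantumLattice.SectorisedKernelNorm
import HarnessLib

/-!
# Re-sectorisation with PRESCRIBED LEGS: the sector sums of a leg-wise transformed kernel family with the fine sectors of a SET of
# legs held fixed cost (per-pair position masses)^{m+1} × (parents per prescribed leg)^{|E|} × (refinement count at fixed prescription)

Topic `MathematicalPhysics/QuantumLattice`; generic layer (label set `P × S`), third member of the family `SectorisedKernelNormRefinement`
(ONE leg prescribed: anchored leg sums, refinement count `R`) / `pinnedSum_refine_le` (ALL legs prescribed: parents count `P`) /
`SectorisedKernelNormRefinementSplit` (count split by a class of coarse tuples).  Benfatto–Giuliani–Mastropietro 2006, §2.8 (2.82)–(2.90) and App. A3: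
in the sectorised tree expansion a vertex whose external legs carry PRESCRIBED sectors is estimated by its anchored norm with those sectors
held fixed and ONE FURTHER leg pinned (the leg through which the spanning tree enters), and when kernels of scale `h_v` are rewritten in the
sectors of a lower scale one pays the number of fine tuples compatible with the prescription AND with conservation refining a coarse tuple
(Lemma A3.1 / (2.89): the more legs are known, the fewer are summed).  For a fine family obtained from a coarse one by a leg-wise transform
`W″_{σ″}(x″) = Σ_{σ′,x′} ∏_i T((x″_i,σ″_i),(x′_i,σ′_i)) · W_{σ′}(x′)` vanishing unless the fine label is a CHILD of the coarse one, a set `E` of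
legs with prescribed fine sectors `τ″|_E` and a position-pinned leg `p ∈ E`:

* `sum_prescribed_fibre_le` — the grouping step: a coarse sum over the tuples COMPATIBLE with the prescription on `E` (leg-wise parents of
  `τ″|_E`), weighted through the pinned leg, is `≤` (parents per leg)^{|E|} × (per-pair row mass) × (largest coarse sum AT FIXED prescription);
* **`prescribedLegSum_refine_le_split`** — with per-pair position sums `Σ_{x″} ‖T‖ ≤ c₁`, `Σ_{x′} ‖T‖ ≤ c₁r`, at most `ρ` parents per fine
  sector, refinement counts AT FIXED PRESCRIPTION `#{σ″ ∈ A″ : σ″|_E = τ″|_E, σ″_i child of σ′_i ∀ i} ≤ R₁` off a class `B` of coarse tuples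
  and `≤ R₂` on it, and bounds `N₁` (resp. `N₂`) on the coarse sums with prescription on `E` over all coarse tuples (resp. over `B`):
  `ε^m Σ_{σ″ ∈ A″, σ″|_E = τ″|_E} Σ_{x″ : x″_p = x} ‖W″_{σ″}(x″)‖ ≤ c₁^m · c₁r · ρ^{|E|} · (R₁ · N₁ + R₂ · N₂)`;
* `prescribedLegSum_refine_le` — the unsplit form `≤ c₁^m · c₁r · ρ^{|E|} · R · N`.

`E = {p}` is the anchored leg sum of `SectorisedKernelNormRefinement(Split)` (`cr ≤ ρ · c₁r`), `E = univ` the per-tuple bound (`P ≤ ρ^{m+1}`,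
`R ≤ 1`); the intermediate `E` are the «tracks» of a bookkeeping carrying kernel sizes by the number of known external sectors (cell
gate-hubbard-kl, K3 engine child, clause (E1): LEVELS track of the blocked birth-level tower, E1-TOWER-BLOCKED §10 (Hμ-L); Grassmann side
`GrassmannVertexPositionsProtected`).  Everything is proved; no definition, no named fact.

## Sources

G. Benfatto, A. Giuliani, V. Mastropietro, Ann. Henri Poincaré 7 (2006) 809–898, §2.8 (2.82)–(2.84), (2.88)–(2.90), App. A3 Lemma A3.1
[`BenfattoGiulianiMastropietro2006`].
-/

noncomputable section

namespace Literature.MathematicalPhysics.QuantumLattice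

open Finset

variable {𝕜 : Type*} [RCLike 𝕜] {S S'' P P'' : Type*} [Fintype S] [DecidableEq S] [DecidableEq S''] [Fintype P] [DecidableEq P]
  [Fintype P''] [DecidableEq P'']

omit [DecidableEq S''] [DecidableEq P] in
/-- **Grouping the compatible coarse tuples by their restriction to the prescribed legs.**  Let `E` be a set of legs, `p ∈ E`, `τ″` a fine
prescription, `child` a relation with at most `ρ` parents per fine sector (`#{s′ : child s″ s′} ≤ ρ`), `a(y, s′) ≥ 0` weights with
`Σ_y a(y, s′) ≤ c₁r` for every `s′`, and `f(σ′, y) ≥ 0` sizes whose sums AT FIXED coarse prescription on `E` are bounded: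
`Σ_{σ′ ∈ Bs, σ′|_E = τ′|_E} f(σ′, y) ≤ N` for all `τ′, y`.  Then the sum over the coarse tuples of `Bs` that are leg-wise parents of `τ″` on `E`
satisfies `Σ_{σ′} Σ_y a(y, σ′_p) f(σ′, y) ≤ ρ^{|E|} · c₁r · N` (the restrictions `σ′|_E` range over at most `∏_{e ∈ E} #parents(τ″_e) ≤ ρ^{|E|}`
values, and each fibre is a sum at fixed prescription). [cite: BenfattoGiulianiMastropietro2006, §2.8 (2.88)-(2.90) and App. A3 Lemma A3.1] -/
theorem sum_prescribed_fibre_le {m : ℕ} (E : Finset (Fin (m + 1))) (p : Fin (m + 1)) (hp : p ∈ E) (τ'' : Fin (m + 1) → S'')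
    (child : S'' → S → Prop) [DecidableRel child] (a : P → S → ℝ) (ha0 : ∀ y s', 0 ≤ a y s')
    {c₁r ρc N : ℝ} (hc₁r : 0 ≤ c₁r) (hN0 : 0 ≤ N)
    (har : ∀ s' : S, ∑ y : P, a y s' ≤ c₁r)
    (hρ : ∀ s'' : S'', (((univ.filter fun s' : S => child s'' s').card : ℝ)) ≤ ρc)
    (Bs : Finset (Fin (m + 1) → S)) (f : (Fin (m + 1) → S) → P → ℝ) (hf0 : ∀ σ' y, 0 ≤ f σ' y)
    (hN : ∀ (τ' : Fin (m + 1) → S) (y : P),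
      ∑ σ' ∈ Bs.filter (fun σ' : Fin (m + 1) → S => ∀ e ∈ E, σ' e = τ' e), f σ' y ≤ N) :
    ∑ σ' ∈ Bs.filter (fun σ' : Fin (m + 1) → S => ∀ e ∈ E, child (τ'' e) (σ' e)), ∑ y : P, a y (σ' p) * f σ' y ≤
      ρc ^ E.card * c₁r * N := by
  have hρc : 0 ≤ ρc := le_trans (Nat.cast_nonneg _) (hρ (τ'' p))
  -- the compatible coarse tuples and the restriction map to the prescribed legs
  set C := Bs.filter (fun σ' : Fin (m + 1) → S => ∀ e ∈ E, child (τ'' e) (σ' e)) with hC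
  set r : (Fin (m + 1) → S) → (E → S) := fun σ' e => σ' e with hr
  set Tset : Finset (E → S) := Fintype.piFinset fun e : E => univ.filter fun s' : S => child (τ'' e) s' with hTset
  have hmaps : ∀ σ' ∈ C, r σ' ∈ Tset := by
    intro σ' hσ'
    rw [hTset, Fintype.mem_piFinset]
    exact fun e => mem_filter.2 ⟨mem_univ _, (mem_filter.1 hσ').2 e e.2⟩
  -- the number of restrictions
  have hcardT : ((Tset.card : ℕ) : ℝ) ≤ ρc ^ E.card := by
    rw [hTset, Fintype.card_piFinset, Nat.cast_prod]
    calc ∏ e : E, (((univ.filter fun s' : S => child (τ'' e) s').card : ℕ) : ℝ) ≤ ∏ _e : E, ρc :=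
          prod_le_prod (fun e _ => Nat.cast_nonneg _) fun e _ => hρ (τ'' e)
      _ = ρc ^ E.card := by rw [prod_const, card_univ, Fintype.card_coe]
  -- each fibre is a sum at fixed coarse prescription
  have hfibre : ∀ κ ∈ Tset, ∑ σ' ∈ C.filter (fun σ' => r σ' = κ), ∑ y : P, a y (σ' p) * f σ' y ≤ c₁r * N := by
    intro κ _
    -- an extension of `κ` to all legs
    set τ' : Fin (m + 1) → S := fun i => if h : i ∈ E then κ ⟨i, h⟩ else κ ⟨p, hp⟩ with hτ'
    have hsub : C.filter (fun σ' => r σ' = κ) ⊆ Bs.filter (fun σ' : Fin (m + 1) → S => ∀ e ∈ E, σ' e = τ' e) := by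
      intro σ' hσ'
      rw [mem_filter] at hσ' ⊢
      refine ⟨(mem_filter.1 hσ'.1).1, fun e he => ?_⟩
      have h := congrFun hσ'.2 ⟨e, he⟩
      simp only [hr] at h
      simpa only [hτ', dif_pos he] using h
    have hpin : ∀ σ' ∈ C.filter (fun σ' => r σ' = κ), σ' p = κ ⟨p, hp⟩ := by
      intro σ' hσ'
      simpa only [hr] using congrFun (mem_filter.1 hσ').2 ⟨p, hp⟩
    calc ∑ σ' ∈ C.filter (fun σ' => r σ' = κ), ∑ y : P, a y (σ' p) * f σ' y
        = ∑ σ' ∈ C.filter (fun σ' => r σ' = κ), ∑ y : P, a y (κ ⟨p, hp⟩) * f σ' y :=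
          sum_congr rfl fun σ' hσ' => by rw [hpin σ' hσ']
      _ = ∑ y : P, a y (κ ⟨p, hp⟩) * ∑ σ' ∈ C.filter (fun σ' => r σ' = κ), f σ' y := by
          rw [Finset.sum_comm]
          exact sum_congr rfl fun y _ => by rw [mul_sum]
      _ ≤ ∑ y : P, a y (κ ⟨p, hp⟩) * N := by
          refine sum_le_sum fun y _ => mul_le_mul_of_nonneg_left ?_ (ha0 y _)
          exact le_trans (sum_le_sum_of_subset_of_nonneg hsub fun σ' _ _ => hf0 σ' y) (hN τ' y)
      _ = (∑ y : P, a y (κ ⟨p, hp⟩)) * N := by rw [Finset.sum_mul]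
      _ ≤ c₁r * N := mul_le_mul_of_nonneg_right (har _) hN0
  -- assemble fibrewise
  calc ∑ σ' ∈ C, ∑ y : P, a y (σ' p) * f σ' y
      = ∑ κ ∈ Tset, ∑ σ' ∈ C.filter (fun σ' => r σ' = κ), ∑ y : P, a y (σ' p) * f σ' y :=
        (Finset.sum_fiberwise_of_maps_to hmaps _).symm
    _ ≤ ∑ _κ ∈ Tset, c₁r * N := sum_le_sum hfibre
    _ = (Tset.card : ℝ) * (c₁r * N) := by rw [sum_const, nsmul_eq_mul]
    _ ≤ ρc ^ E.card * (c₁r * N) := mul_le_mul_of_nonneg_right hcardT (mul_nonneg hc₁r hN0)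
    _ = ρc ^ E.card * c₁r * N := by ring

/-- **Prescribed-legs sector sums under a child-supported leg-wise transform, split by a class of coarse tuples** (BGM 2006 App. A3
Lemma A3.1, §2.8 (2.82)–(2.84), (2.88)–(2.90): one overlap `L¹` norm per leg, the parents of the prescribed sectors, the refinement count AT FIXED
PRESCRIPTION, correlated through a class `B` of coarse configurations).  `W″_{σ″}(x″) = Σ_{σ′,x′} ∏_i T((x″_i,σ″_i),(x′_i,σ′_i)) W_{σ′}(x′)`,
`T = 0` off the child relation, per-pair position sums `≤ c₁` (fine summed) and `≤ c₁r` (coarse summed), `≤ ρ` coarse parents per fine sector;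
`E` a set of legs, `p ∈ E`, `τ″` a fine prescription; the number of `σ″ ∈ A″` with `σ″|_E = τ″|_E` refining `σ′` leg by leg is `≤ R₁` off `B`,
`≤ R₂` on `B`; `N₁` bounds `ε^m Σ_{σ′ : σ′|_E = τ′|_E} Σ_{x′ : x′_p = y} ‖W_{σ′}(x′)‖` and `N₂` the same over `σ′ ∈ B`, for all `τ′, y`.  Then
`ε^m Σ_{σ″ ∈ A″, σ″|_E = τ″|_E} Σ_{x″ : x″_p = x} ‖W″_{σ″}(x″)‖ ≤ c₁^m · c₁r · ρ^{|E|} · (R₁ · N₁ + R₂ · N₂)`.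
[cite: BenfattoGiulianiMastropietro2006, §2.8 (2.82)-(2.84) and (2.88)-(2.90), App. A3 Lemma A3.1] -/
theorem prescribedLegSum_refine_le_split {ε : ℝ} (hε : 0 ≤ ε) {m : ℕ} (T : P'' × S'' → P × S → 𝕜) (child : S'' → S → Prop)
    [DecidableRel child] (hT0 : ∀ x'' s'' x' s', ¬ child s'' s' → T (x'', s'') (x', s') = 0)
    {c₁ c₁r ρc R₁ R₂ N₁ N₂ : ℝ} (hc₁ : 0 ≤ c₁) (hc₁r : 0 ≤ c₁r) (hR₁ : 0 ≤ R₁) (hR₂ : 0 ≤ R₂) (hN₁0 : 0 ≤ N₁) (hN₂0 : 0 ≤ N₂)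
    (h1 : ∀ (s'' : S'') (x' : P) (s' : S), ∑ x'' : P'', ‖T (x'', s'') (x', s')‖ ≤ c₁)
    (h1r : ∀ (x'' : P'') (s'' : S'') (s' : S), ∑ x' : P, ‖T (x'', s'') (x', s')‖ ≤ c₁r)
    (hρ : ∀ s'' : S'', (((univ.filter fun s' : S => child s'' s').card : ℝ)) ≤ ρc)
    (A'' : Finset (Fin (m + 1) → S'')) (B : Finset (Fin (m + 1) → S))
    (E : Finset (Fin (m + 1))) (τ'' : Fin (m + 1) → S'') (p : Fin (m + 1)) (hp : p ∈ E)
    (hRoff : ∀ σ' : Fin (m + 1) → S, σ' ∉ B →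
      (((A''.filter fun σ'' => (∀ e ∈ E, σ'' e = τ'' e) ∧ ∀ i, child (σ'' i) (σ' i)).card : ℝ)) ≤ R₁)
    (hRon : ∀ σ' : Fin (m + 1) → S, σ' ∈ B →
      (((A''.filter fun σ'' => (∀ e ∈ E, σ'' e = τ'' e) ∧ ∀ i, child (σ'' i) (σ' i)).card : ℝ)) ≤ R₂)
    (W : (Fin (m + 1) → S) → (Fin (m + 1) → P) → 𝕜)
    (hN₁ : ∀ (τ' : Fin (m + 1) → S) (y : P),
      ε ^ m * ∑ σ' ∈ univ.filter (fun σ' : Fin (m + 1) → S => ∀ e ∈ E, σ' e = τ' e),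
        ∑ x' ∈ univ.filter (fun x' : Fin (m + 1) → P => x' p = y), ‖W σ' x'‖ ≤ N₁)
    (hN₂ : ∀ (τ' : Fin (m + 1) → S) (y : P),
      ε ^ m * ∑ σ' ∈ B.filter (fun σ' : Fin (m + 1) → S => ∀ e ∈ E, σ' e = τ' e),
        ∑ x' ∈ univ.filter (fun x' : Fin (m + 1) → P => x' p = y), ‖W σ' x'‖ ≤ N₂)
    (x : P'') :
    ε ^ m * ∑ σ'' ∈ A''.filter (fun σ'' => ∀ e ∈ E, σ'' e = τ'' e),
        ∑ x'' ∈ univ.filter (fun x'' : Fin (m + 1) → P'' => x'' p = x),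
          ‖∑ σ' : Fin (m + 1) → S, ∑ x' : Fin (m + 1) → P, (∏ i, T (x'' i, σ'' i) (x' i, σ' i)) * W σ' x'‖ ≤
      c₁ ^ m * c₁r * ρc ^ E.card * (R₁ * N₁ + R₂ * N₂) := by
  have hρc : 0 ≤ ρc := le_trans (Nat.cast_nonneg _) (hρ (τ'' p))
  -- abbreviations
  set a : Fin (m + 1) → P'' → S'' → P → S → ℝ := fun _ x'' s'' x' s' => ‖T (x'', s'') (x', s')‖ with ha
  have ha0 : ∀ i x'' s'' x' s', 0 ≤ a i x'' s'' x' s' := fun _ _ _ _ _ => norm_nonneg _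
  set AE := A''.filter (fun σ'' => ∀ e ∈ E, σ'' e = τ'' e) with hAE
  set Xp := univ.filter (fun x'' : Fin (m + 1) → P'' => x'' p = x) with hXp
  -- the compatibility of a coarse tuple with the prescription
  let compat : (Fin (m + 1) → S) → Prop := fun σ' => ∀ e ∈ E, child (τ'' e) (σ' e)
  -- the pinned sizes of the coarse family
  set f : (Fin (m + 1) → S) → P → ℝ := fun σ' y =>
    ε ^ m * ∑ x' ∈ univ.filter (fun x' : Fin (m + 1) → P => x' p = y), ‖W σ' x'‖ with hf
  have hf0 : ∀ σ' y, 0 ≤ f σ' y := fun σ' y => mul_nonneg (pow_nonneg hε _) (sum_nonneg fun _ _ => norm_nonneg _)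
  -- Step 1: triangle inequality and reordering of the sums
  have step1 : ε ^ m * ∑ σ'' ∈ AE, ∑ x'' ∈ Xp,
        ‖∑ σ' : Fin (m + 1) → S, ∑ x' : Fin (m + 1) → P, (∏ i, T (x'' i, σ'' i) (x' i, σ' i)) * W σ' x'‖ ≤
      ∑ σ' : Fin (m + 1) → S, ∑ x' : Fin (m + 1) → P, ‖W σ' x'‖ *
        (ε ^ m * ∑ σ'' ∈ AE, ∑ x'' ∈ Xp, ∏ i, a i (x'' i) (σ'' i) (x' i) (σ' i)) := by
    calc ε ^ m * ∑ σ'' ∈ AE, ∑ x'' ∈ Xp,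
          ‖∑ σ' : Fin (m + 1) → S, ∑ x' : Fin (m + 1) → P, (∏ i, T (x'' i, σ'' i) (x' i, σ' i)) * W σ' x'‖
        ≤ ε ^ m * ∑ σ'' ∈ AE, ∑ x'' ∈ Xp, ∑ σ' : Fin (m + 1) → S, ∑ x' : Fin (m + 1) → P,
            (∏ i, a i (x'' i) (σ'' i) (x' i) (σ' i)) * ‖W σ' x'‖ := by
          refine mul_le_mul_of_nonneg_left (sum_le_sum fun σ'' _ => sum_le_sum fun x'' _ => ?_) (pow_nonneg hε _)
          refine (norm_sum_le _ _).trans (sum_le_sum fun σ' _ => (norm_sum_le _ _).trans (sum_le_sum fun x' _ => ?_))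
          rw [norm_mul, norm_prod]
      _ = _ := by
          rw [mul_sum]
          calc ∑ σ'' ∈ AE, ε ^ m * ∑ x'' ∈ Xp, ∑ σ' : Fin (m + 1) → S, ∑ x' : Fin (m + 1) → P,
                (∏ i, a i (x'' i) (σ'' i) (x' i) (σ' i)) * ‖W σ' x'‖
              = ∑ σ'' ∈ AE, ∑ x'' ∈ Xp, ∑ σ' : Fin (m + 1) → S, ∑ x' : Fin (m + 1) → P,
                  ε ^ m * ((∏ i, a i (x'' i) (σ'' i) (x' i) (σ' i)) * ‖W σ' x'‖) := by
                simp only [mul_sum]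
            _ = ∑ σ'' ∈ AE, ∑ σ' : Fin (m + 1) → S, ∑ x'' ∈ Xp, ∑ x' : Fin (m + 1) → P,
                  ε ^ m * ((∏ i, a i (x'' i) (σ'' i) (x' i) (σ' i)) * ‖W σ' x'‖) :=
                sum_congr rfl fun σ'' _ => Finset.sum_comm
            _ = ∑ σ' : Fin (m + 1) → S, ∑ σ'' ∈ AE, ∑ x'' ∈ Xp, ∑ x' : Fin (m + 1) → P,
                  ε ^ m * ((∏ i, a i (x'' i) (σ'' i) (x' i) (σ' i)) * ‖W σ' x'‖) := Finset.sum_comm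
            _ = ∑ σ' : Fin (m + 1) → S, ∑ σ'' ∈ AE, ∑ x' : Fin (m + 1) → P, ∑ x'' ∈ Xp,
                  ε ^ m * ((∏ i, a i (x'' i) (σ'' i) (x' i) (σ' i)) * ‖W σ' x'‖) :=
                sum_congr rfl fun σ' _ => sum_congr rfl fun σ'' _ => Finset.sum_comm
            _ = ∑ σ' : Fin (m + 1) → S, ∑ x' : Fin (m + 1) → P, ∑ σ'' ∈ AE, ∑ x'' ∈ Xp,
                  ε ^ m * ((∏ i, a i (x'' i) (σ'' i) (x' i) (σ' i)) * ‖W σ' x'‖) :=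
                sum_congr rfl fun σ' _ => Finset.sum_comm
            _ = _ := by
                refine sum_congr rfl fun σ' _ => sum_congr rfl fun x' _ => ?_
                rw [mul_sum, mul_sum]
                refine sum_congr rfl fun σ'' _ => ?_
                rw [mul_sum, mul_sum]
                exact sum_congr rfl fun x'' _ => by ring
  -- Step 2: the position sums factorise leg by leg; the pinned leg keeps its entry, the others cost `c₁` (or `0` off the children)
  have step2 : ∀ (σ'' : Fin (m + 1) → S'') (σ' : Fin (m + 1) → S) (x' : Fin (m + 1) → P), σ'' p = τ'' p →
      ∑ x'' ∈ Xp, ∏ i, a i (x'' i) (σ'' i) (x' i) (σ' i) ≤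
        a p x (τ'' p) (x' p) (σ' p) * (if ∀ i, child (σ'' i) (σ' i) then c₁ ^ m else 0) := by
    intro σ'' σ' x' hσp
    set t : Fin (m + 1) → Finset P'' := fun i => if i = p then {x} else univ with ht
    have hset : Xp = Fintype.piFinset t := by
      ext x''
      simp only [hXp, mem_filter, mem_univ, true_and, Fintype.mem_piFinset, ht]
      refine ⟨fun h i => ?_, fun h => by simpa using h p⟩
      split_ifs with hi
      · subst hi; simp [h]
      · exact mem_univ _
    have hfac : ∑ x'' ∈ Xp, ∏ i, a i (x'' i) (σ'' i) (x' i) (σ' i) =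
        a p x (σ'' p) (x' p) (σ' p) * ∏ i ∈ univ.erase p, ∑ j ∈ t i, a i j (σ'' i) (x' i) (σ' i) := by
      rw [hset, ← prod_univ_sum t (fun i j => a i j (σ'' i) (x' i) (σ' i)),
        ← Finset.mul_prod_erase univ (fun i => ∑ j ∈ t i, a i j (σ'' i) (x' i) (σ' i)) (mem_univ p)]
      congr 1
      simp only [ht, if_true, sum_singleton]
    rw [hfac, hσp]
    split_ifs with hch
    · refine mul_le_mul_of_nonneg_left ?_ (ha0 p x (τ'' p) (x' p) (σ' p))
      have hcard : (univ.erase p).card = m := by rw [card_erase_of_mem (mem_univ p), card_univ, Fintype.card_fin]; omega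
      calc ∏ i ∈ univ.erase p, ∑ j ∈ t i, a i j (σ'' i) (x' i) (σ' i) ≤ ∏ i ∈ univ.erase p, c₁ := by
            refine prod_le_prod (fun i _ => sum_nonneg fun j _ => ha0 i j _ _ _) fun i hi => ?_
            have hip : i ≠ p := ne_of_mem_erase hi
            simp only [ht, if_neg hip]
            exact h1 _ _ _
        _ = c₁ ^ m := by rw [prod_const, hcard]
    · rw [mul_zero]
      push Not at hch
      obtain ⟨i, hi⟩ := hch
      by_cases hip : i = p
      · subst hip
        have hz : a i x (τ'' i) (x' i) (σ' i) = 0 := by simp only [ha]; rw [hT0 _ _ _ _ (hσp ▸ hi), norm_zero]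
        rw [hz, zero_mul]
      · refine le_of_eq ?_
        rw [prod_eq_zero (mem_erase.2 ⟨hip, mem_univ i⟩) ?_, mul_zero]
        simp only [ht, if_neg hip]
        exact sum_eq_zero fun j _ => by simp only [ha]; rw [hT0 _ _ _ _ hi, norm_zero]
  -- Step 3: the sector sum over the admissible fine tuples costs the refinement count at fixed prescription, `R₁` off the class and
  -- `R₂` on it, and VANISHES unless the coarse tuple is compatible with the prescription
  have step3 : ∀ (σ' : Fin (m + 1) → S) (x' : Fin (m + 1) → P),
      ∑ σ'' ∈ AE, ∑ x'' ∈ Xp, ∏ i, a i (x'' i) (σ'' i) (x' i) (σ' i) ≤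
        a p x (τ'' p) (x' p) (σ' p) *
          (c₁ ^ m * (if compat σ' then (if σ' ∈ B then R₂ else R₁) else 0)) := by
    intro σ' x'
    have hRσ : (((A''.filter fun σ'' => (∀ e ∈ E, σ'' e = τ'' e) ∧ ∀ i, child (σ'' i) (σ' i)).card : ℝ)) ≤
        (if compat σ' then (if σ' ∈ B then R₂ else R₁) else 0) := by
      split_ifs with hc hB
      · exact hRon σ' hB
      · exact hRoff σ' hB
      · -- incompatible coarse tuple: no admissible fine tuple refines it
        have hem : (A''.filter fun σ'' => (∀ e ∈ E, σ'' e = τ'' e) ∧ ∀ i, child (σ'' i) (σ' i)) = ∅ := by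
          rw [Finset.filter_eq_empty_iff]
          intro σ'' _ hσ''
          exact hc fun e he => by rw [← hσ''.1 e he]; exact hσ''.2 e
        rw [hem, card_empty, Nat.cast_zero]
    calc ∑ σ'' ∈ AE, ∑ x'' ∈ Xp, ∏ i, a i (x'' i) (σ'' i) (x' i) (σ' i)
        ≤ ∑ σ'' ∈ AE, a p x (τ'' p) (x' p) (σ' p) * (if ∀ i, child (σ'' i) (σ' i) then c₁ ^ m else 0) :=
          sum_le_sum fun σ'' hσ'' => step2 σ'' σ' x' ((mem_filter.1 hσ'').2 p hp)
      _ = a p x (τ'' p) (x' p) (σ' p) * (c₁ ^ m *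
            (((A''.filter fun σ'' => (∀ e ∈ E, σ'' e = τ'' e) ∧ ∀ i, child (σ'' i) (σ' i)).card : ℝ))) := by
          rw [← mul_sum, ← sum_filter, hAE, filter_filter, sum_const, nsmul_eq_mul]
          ring
      _ ≤ _ := mul_le_mul_of_nonneg_left (mul_le_mul_of_nonneg_left hRσ (pow_nonneg hc₁ _)) (ha0 p x _ (x' p) (σ' p))
  -- Step 4: the coarse sums restricted to compatible tuples, fibrewise over the pinned leg and grouped by the restriction to `E`
  have step4 : ∀ Bs : Finset (Fin (m + 1) → S), ∀ N : ℝ, 0 ≤ N →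
      (∀ (τ' : Fin (m + 1) → S) (y : P),
        ε ^ m * ∑ σ' ∈ Bs.filter (fun σ' : Fin (m + 1) → S => ∀ e ∈ E, σ' e = τ' e),
          ∑ x' ∈ univ.filter (fun x' : Fin (m + 1) → P => x' p = y), ‖W σ' x'‖ ≤ N) →
      ∑ σ' ∈ Bs.filter (fun σ' => compat σ'), ∑ x' : Fin (m + 1) → P,
          ‖W σ' x'‖ * (ε ^ m * a p x (τ'' p) (x' p) (σ' p)) ≤ ρc ^ E.card * c₁r * N := by
    intro Bs N hN0 hN
    -- fiberwise over the pinned position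
    have hfib : ∀ σ' : Fin (m + 1) → S,
        ∑ x' : Fin (m + 1) → P, ‖W σ' x'‖ * (ε ^ m * a p x (τ'' p) (x' p) (σ' p)) =
          ∑ y : P, a p x (τ'' p) y (σ' p) * f σ' y := by
      intro σ'
      rw [← Finset.sum_fiberwise univ (fun x' : Fin (m + 1) → P => x' p) _]
      refine sum_congr rfl fun y _ => ?_
      simp only [hf]
      rw [mul_sum, mul_sum]
      exact sum_congr rfl fun x' hx' => by rw [(mem_filter.1 hx').2]; ring
    rw [sum_congr rfl fun σ' _ => hfib σ']
    refine sum_prescribed_fibre_le E p hp τ'' child (fun y s' => a p x (τ'' p) y s') (fun y s' => ha0 p x _ y s')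
      hc₁r hN0 (fun s' => h1r x (τ'' p) s') hρ Bs f hf0 fun τ' y => ?_
    simpa only [hf, ← mul_sum] using hN τ' y
  -- the split of the count, pointwise
  have hsplit : ∀ (σ' : Fin (m + 1) → S) (x' : Fin (m + 1) → P),
      ‖W σ' x'‖ * (ε ^ m * (a p x (τ'' p) (x' p) (σ' p) *
        (c₁ ^ m * (if compat σ' then (if σ' ∈ B then R₂ else R₁) else 0)))) ≤
        (if compat σ' then c₁ ^ m * R₁ * (‖W σ' x'‖ * (ε ^ m * a p x (τ'' p) (x' p) (σ' p))) else 0) +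
          (if compat σ' ∧ σ' ∈ B then c₁ ^ m * R₂ * (‖W σ' x'‖ * (ε ^ m * a p x (τ'' p) (x' p) (σ' p))) else 0) := by
    intro σ' x'
    have hq : 0 ≤ ‖W σ' x'‖ * (ε ^ m * a p x (τ'' p) (x' p) (σ' p)) :=
      mul_nonneg (norm_nonneg _) (mul_nonneg (pow_nonneg hε _) (ha0 p x _ (x' p) (σ' p)))
    have hc : 0 ≤ c₁ ^ m := pow_nonneg hc₁ _
    by_cases hco : compat σ'
    · by_cases hB : σ' ∈ B
      · have h0 : 0 ≤ c₁ ^ m * R₁ * (‖W σ' x'‖ * (ε ^ m * a p x (τ'' p) (x' p) (σ' p))) := by positivity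
        simp only [hco, hB, if_true, and_self]
        calc ‖W σ' x'‖ * (ε ^ m * (a p x (τ'' p) (x' p) (σ' p) * (c₁ ^ m * R₂)))
            = c₁ ^ m * R₂ * (‖W σ' x'‖ * (ε ^ m * a p x (τ'' p) (x' p) (σ' p))) := by ring
          _ ≤ _ := le_add_of_nonneg_left h0
      · have h0 : 0 ≤ c₁ ^ m * R₂ * (‖W σ' x'‖ * (ε ^ m * a p x (τ'' p) (x' p) (σ' p))) := by positivity
        simp only [hco, hB, if_true, if_false, and_false, add_zero]
        exact le_of_eq (by ring)
    · simp only [hco, if_false, false_and, mul_zero, add_zero]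
      exact le_refl _
  -- the two coarse sums
  have hsumU : ∑ σ' : Fin (m + 1) → S, ∑ x' : Fin (m + 1) → P,
      (if compat σ' then c₁ ^ m * R₁ * (‖W σ' x'‖ * (ε ^ m * a p x (τ'' p) (x' p) (σ' p))) else 0) ≤
        c₁ ^ m * R₁ * (ρc ^ E.card * c₁r * N₁) := by
    have hre : ∑ σ' : Fin (m + 1) → S, ∑ x' : Fin (m + 1) → P,
        (if compat σ' then c₁ ^ m * R₁ * (‖W σ' x'‖ * (ε ^ m * a p x (τ'' p) (x' p) (σ' p))) else 0) =
        c₁ ^ m * R₁ * ∑ σ' ∈ univ.filter (fun σ' => compat σ'), ∑ x' : Fin (m + 1) → P,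
          ‖W σ' x'‖ * (ε ^ m * a p x (τ'' p) (x' p) (σ' p)) := by
      calc ∑ σ' : Fin (m + 1) → S, ∑ x' : Fin (m + 1) → P,
            (if compat σ' then c₁ ^ m * R₁ * (‖W σ' x'‖ * (ε ^ m * a p x (τ'' p) (x' p) (σ' p))) else 0)
          = ∑ σ' : Fin (m + 1) → S, (if compat σ' then ∑ x' : Fin (m + 1) → P,
              c₁ ^ m * R₁ * (‖W σ' x'‖ * (ε ^ m * a p x (τ'' p) (x' p) (σ' p))) else 0) :=
            sum_congr rfl fun σ' _ => by split_ifs <;> simp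
        _ = ∑ σ' ∈ univ.filter (fun σ' => compat σ'), ∑ x' : Fin (m + 1) → P,
              c₁ ^ m * R₁ * (‖W σ' x'‖ * (ε ^ m * a p x (τ'' p) (x' p) (σ' p))) := by
            rw [← sum_filter]
        _ = _ := by rw [mul_sum]; exact sum_congr rfl fun σ' _ => by rw [mul_sum]
    rw [hre]
    exact mul_le_mul_of_nonneg_left (step4 univ N₁ hN₁0 hN₁) (by positivity)
  have hsumB : ∑ σ' : Fin (m + 1) → S, ∑ x' : Fin (m + 1) → P,
      (if compat σ' ∧ σ' ∈ B then c₁ ^ m * R₂ * (‖W σ' x'‖ * (ε ^ m * a p x (τ'' p) (x' p) (σ' p))) else 0) ≤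
        c₁ ^ m * R₂ * (ρc ^ E.card * c₁r * N₂) := by
    have hre : ∑ σ' : Fin (m + 1) → S, ∑ x' : Fin (m + 1) → P,
        (if compat σ' ∧ σ' ∈ B then c₁ ^ m * R₂ * (‖W σ' x'‖ * (ε ^ m * a p x (τ'' p) (x' p) (σ' p))) else 0) =
        c₁ ^ m * R₂ * ∑ σ' ∈ B.filter (fun σ' => compat σ'), ∑ x' : Fin (m + 1) → P,
          ‖W σ' x'‖ * (ε ^ m * a p x (τ'' p) (x' p) (σ' p)) := by
      calc ∑ σ' : Fin (m + 1) → S, ∑ x' : Fin (m + 1) → P,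
            (if compat σ' ∧ σ' ∈ B then c₁ ^ m * R₂ * (‖W σ' x'‖ * (ε ^ m * a p x (τ'' p) (x' p) (σ' p))) else 0)
          = ∑ σ' : Fin (m + 1) → S, (if compat σ' ∧ σ' ∈ B then ∑ x' : Fin (m + 1) → P,
              c₁ ^ m * R₂ * (‖W σ' x'‖ * (ε ^ m * a p x (τ'' p) (x' p) (σ' p))) else 0) :=
            sum_congr rfl fun σ' _ => by split_ifs <;> simp
        _ = ∑ σ' ∈ B.filter (fun σ' => compat σ'), ∑ x' : Fin (m + 1) → P,
              c₁ ^ m * R₂ * (‖W σ' x'‖ * (ε ^ m * a p x (τ'' p) (x' p) (σ' p))) := by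
            rw [← sum_filter]
            congr 1
            ext σ'
            simp only [mem_filter, mem_univ, true_and]
            exact and_comm
        _ = _ := by rw [mul_sum]; exact sum_congr rfl fun σ' _ => by rw [mul_sum]
    rw [hre]
    exact mul_le_mul_of_nonneg_left (step4 B N₂ hN₂0 hN₂) (by positivity)
  -- assemble
  calc ε ^ m * ∑ σ'' ∈ AE, ∑ x'' ∈ Xp,
        ‖∑ σ' : Fin (m + 1) → S, ∑ x' : Fin (m + 1) → P, (∏ i, T (x'' i, σ'' i) (x' i, σ' i)) * W σ' x'‖
      ≤ ∑ σ' : Fin (m + 1) → S, ∑ x' : Fin (m + 1) → P, ‖W σ' x'‖ *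
          (ε ^ m * ∑ σ'' ∈ AE, ∑ x'' ∈ Xp, ∏ i, a i (x'' i) (σ'' i) (x' i) (σ' i)) := step1
    _ ≤ ∑ σ' : Fin (m + 1) → S, ∑ x' : Fin (m + 1) → P,
          ‖W σ' x'‖ * (ε ^ m * (a p x (τ'' p) (x' p) (σ' p) *
            (c₁ ^ m * (if compat σ' then (if σ' ∈ B then R₂ else R₁) else 0)))) :=
        sum_le_sum fun σ' _ => sum_le_sum fun x' _ =>
          mul_le_mul_of_nonneg_left (mul_le_mul_of_nonneg_left (step3 σ' x') (pow_nonneg hε _)) (norm_nonneg _)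
    _ ≤ ∑ σ' : Fin (m + 1) → S, ∑ x' : Fin (m + 1) → P,
          ((if compat σ' then c₁ ^ m * R₁ * (‖W σ' x'‖ * (ε ^ m * a p x (τ'' p) (x' p) (σ' p))) else 0) +
            (if compat σ' ∧ σ' ∈ B then c₁ ^ m * R₂ * (‖W σ' x'‖ * (ε ^ m * a p x (τ'' p) (x' p) (σ' p))) else 0)) :=
        sum_le_sum fun σ' _ => sum_le_sum fun x' _ => hsplit σ' x'
    _ = (∑ σ' : Fin (m + 1) → S, ∑ x' : Fin (m + 1) → P,
            (if compat σ' then c₁ ^ m * R₁ * (‖W σ' x'‖ * (ε ^ m * a p x (τ'' p) (x' p) (σ' p))) else 0)) +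
          ∑ σ' : Fin (m + 1) → S, ∑ x' : Fin (m + 1) → P,
            (if compat σ' ∧ σ' ∈ B then c₁ ^ m * R₂ * (‖W σ' x'‖ * (ε ^ m * a p x (τ'' p) (x' p) (σ' p))) else 0) := by
        rw [← sum_add_distrib]
        exact sum_congr rfl fun σ' _ => sum_add_distrib
    _ ≤ c₁ ^ m * R₁ * (ρc ^ E.card * c₁r * N₁) + c₁ ^ m * R₂ * (ρc ^ E.card * c₁r * N₂) := add_le_add hsumU hsumB
    _ = c₁ ^ m * c₁r * ρc ^ E.card * (R₁ * N₁ + R₂ * N₂) := by ring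

/-- **Prescribed-legs sector sums under a child-supported leg-wise transform** (unsplit form of `prescribedLegSum_refine_le_split`): with one
refinement count `R` at fixed prescription for every coarse tuple and one bound `N` on the coarse sums at fixed coarse prescription on `E`,
`ε^m Σ_{σ″ ∈ A″, σ″|_E = τ″|_E} Σ_{x″ : x″_p = x} ‖W″_{σ″}(x″)‖ ≤ c₁^m · c₁r · ρ^{|E|} · R · N`.  `E = {p}`: the anchored leg sums
(`sectorLegSum_refine_le`, with `cr ≤ ρ · c₁r`); `E = univ`: the per-tuple sizes (`pinnedSum_refine_le`, with `P ≤ ρ^{m+1}`, `R ≤ 1`).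
[cite: BenfattoGiulianiMastropietro2006, §2.8 (2.82)-(2.84) and (2.88)-(2.90), App. A3 Lemma A3.1] -/
theorem prescribedLegSum_refine_le {ε : ℝ} (hε : 0 ≤ ε) {m : ℕ} (T : P'' × S'' → P × S → 𝕜) (child : S'' → S → Prop)
    [DecidableRel child] (hT0 : ∀ x'' s'' x' s', ¬ child s'' s' → T (x'', s'') (x', s') = 0)
    {c₁ c₁r ρc R N : ℝ} (hc₁ : 0 ≤ c₁) (hc₁r : 0 ≤ c₁r) (hR : 0 ≤ R) (hN0 : 0 ≤ N)
    (h1 : ∀ (s'' : S'') (x' : P) (s' : S), ∑ x'' : P'', ‖T (x'', s'') (x', s')‖ ≤ c₁)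
    (h1r : ∀ (x'' : P'') (s'' : S'') (s' : S), ∑ x' : P, ‖T (x'', s'') (x', s')‖ ≤ c₁r)
    (hρ : ∀ s'' : S'', (((univ.filter fun s' : S => child s'' s').card : ℝ)) ≤ ρc)
    (A'' : Finset (Fin (m + 1) → S'')) (E : Finset (Fin (m + 1))) (τ'' : Fin (m + 1) → S'') (p : Fin (m + 1)) (hp : p ∈ E)
    (hRc : ∀ σ' : Fin (m + 1) → S,
      (((A''.filter fun σ'' => (∀ e ∈ E, σ'' e = τ'' e) ∧ ∀ i, child (σ'' i) (σ' i)).card : ℝ)) ≤ R)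
    (W : (Fin (m + 1) → S) → (Fin (m + 1) → P) → 𝕜)
    (hN : ∀ (τ' : Fin (m + 1) → S) (y : P),
      ε ^ m * ∑ σ' ∈ univ.filter (fun σ' : Fin (m + 1) → S => ∀ e ∈ E, σ' e = τ' e),
        ∑ x' ∈ univ.filter (fun x' : Fin (m + 1) → P => x' p = y), ‖W σ' x'‖ ≤ N)
    (x : P'') :
    ε ^ m * ∑ σ'' ∈ A''.filter (fun σ'' => ∀ e ∈ E, σ'' e = τ'' e),
        ∑ x'' ∈ univ.filter (fun x'' : Fin (m + 1) → P'' => x'' p = x),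
          ‖∑ σ' : Fin (m + 1) → S, ∑ x' : Fin (m + 1) → P, (∏ i, T (x'' i, σ'' i) (x' i, σ' i)) * W σ' x'‖ ≤
      c₁ ^ m * c₁r * ρc ^ E.card * R * N := by
  have h := prescribedLegSum_refine_le_split hε T child hT0 (B := ∅) (R₂ := 0) (N₂ := 0) hc₁ hc₁r hR le_rfl hN0 le_rfl h1 h1r hρ
    A'' E τ'' p hp (fun σ' _ => hRc σ') (fun σ' h => absurd h (Finset.notMem_empty _)) W hN
    (fun τ' y => by simp) x
  calc _ ≤ c₁ ^ m * c₁r * ρc ^ E.card * (R * N + 0 * 0) := h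
    _ = c₁ ^ m * c₁r * ρc ^ E.card * R * N := by ring

end Literature.MathematicalPhysics.QuantumLattice

end
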